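import Mathlib
import HarnessLib
import HarnessLib.Audit
import Summits.AtomisticToContinuum.Statement
import Literature.MathematicalPhysics.QuantumManyBody.PeriodicBoseGas
import Literature.MathematicalPhysics.QuantumManyBody.AmplitudeCorrelation
import HarnessLib.Audit.Status.Attr

/-!
Route: BECAmplitudeGas

DORMANT since 2026-08-29T19:24:42Z (census g0: costume|duplicate of —; reader census-reader-31-g0) — unstaffed, not closed; items shared with open routes are served there. `ledger route dormant <id> --off` reactivates.

# Route BECAmplitudeGas — Lieb's amplitude gas un-closed — closure defects at rate √(ρa³) cap the
pinned slope by Bogoliubov's constant, hence torus BEC; dense first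

It suffices to show X = PinnedSlopeBound ∧ SlopeToCondensation ∧ BoundaryTransferWeak (card
lieb-amplitude-hierarchy-unclosed; conforming
re-open of the retired gen-1 route BECAmplitudeHierarchy, whose only defect was an assembly
concluding the Literature constant instead of the
sub-problem Statement `BoseEinsteinCondensation`). PinnedSlopeBound is the OUTPUT node of Lieb's
amplitude-gas programme, stated variationally
and without eigenfunctions: for every repulsive finite-range v there are C, ρ₀ with, for 0 < ρ < ρ₀,
all large N and EVERY μ > 0, pinned torus
energy E^(μ)(N,L) := inf_Ψ [⟨Ψ,HΨ⟩ + μ(N − ⟨Ψ,n₀Ψ⟩)] ≤ E₀^per + μ·C√(ρa³)·N (L = (N/ρ)^(1/3), n₀ =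
constant-mode number; CJL's H + μΣ_j(1 − P_j));
by concavity in μ this says the torus ground state has depletion ≤ C√(ρa³)N. SlopeToCondensation is
the fixed-N Hellmann–Feynman transfer from a
slope bound to n₀ ≥ (1 − η − ε)N on all δ-near-minimisers; BoundaryTransferWeak (shared verbatim
with BECPeriodicReduction, stmt-0827) turns periodic
constant-mode BEC into the conjunct's Dirichlet HasGroundStateBEC. NEW IN THIS GENERATION: the
mechanism layer is TYPED, because both gen-1 definition
requests have landed (AmplitudeCorrelation.lean: g_p, h₃, h₄; LiebSimpleEquation*.lean: CJL objects,
CJL-I Thm 1 proved in tree): ClosureDefectBound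
(#2, Jauslin's open problem 8.1 with the rate √(ρa³), in the v-weighted L¹ norms of the level-2
equation) and CJLSlopeBound (#3, the contraction's
output: the pinned slope is capped by Bogoliubov's/CJL's constant 8/(3√π) asymptotically), with
PinnedSlopeBound (#4) their one-line corollary and
HighDensityCondensation (#5) the dense-first calibration rung.
Lean: `(∀ v : ℝ → ENNReal,
Literature.MathematicalPhysics.QuantumManyBody.BoseGas.IsRepulsiveFiniteRange v → ∃ C ρ₀ : ℝ, 0 < ρ₀
∧ ∀ ρ : ℝ, 0 < ρ → ρ < ρ₀ → ∀ᶠ N : ℕ in Filter.atTop, ∀ μ : ℝ, 0 < μ → (⨅ Ψ :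
Literature.MathematicalPhysics.QuantumManyBody.BoseGas.PeriodicTrialState N
(Literature.MathematicalPhysics.QuantumManyBody.BoseGas.sideLength ρ N),
Literature.MathematicalPhysics.QuantumManyBody.BoseGas.periodicEnergy v Ψ + ENNReal.ofReal μ * ((N :
ENNReal) - Literature.MathematicalPhysics.QuantumManyBody.BoseGas.condensateOccupation N
(Literature.MathematicalPhysics.QuantumManyBody.BoseGas.sideLength ρ N) Ψ.ψ)) ≤
Literature.MathematicalPhysics.QuantumManyBody.BoseGas.periodicGroundStateEnergy v N
(Literature.MathematicalPhysics.QuantumManyBody.BoseGas.sideLength ρ N) + ENNReal.ofReal (μ * (C *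
Real.sqrt (ρ * (Literature.MathematicalPhysics.QuantumManyBody.BoseGas.scatteringLength v).toReal ^
3)) * N)) ∧ (∀ v : ℝ → ENNReal,
Literature.MathematicalPhysics.QuantumManyBody.BoseGas.IsRepulsiveFiniteRange v → ∃ ρ₁ : ℝ, 0 < ρ₁ ∧
∀ ρ : ℝ, 0 < ρ → ρ < ρ₁ → ∀ᶠ N : ℕ in Filter.atTop, ∀ η : ℝ, 0 ≤ η → (∀ μ : ℝ, 0 < μ → (⨅ Ψ :
Literature.MathematicalPhysics.QuantumManyBody.BoseGas.PeriodicTrialState N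
(Literature.MathematicalPhysics.QuantumManyBody.BoseGas.sideLength ρ N),
Literature.MathematicalPhysics.QuantumManyBody.BoseGas.periodicEnergy v Ψ + ENNReal.ofReal μ * ((N :
ENNReal) - Literature.MathematicalPhysics.QuantumManyBody.BoseGas.condensateOccupation N
(Literature.MathematicalPhysics.QuantumManyBody.BoseGas.sideLength ρ N) Ψ.ψ)) ≤
Literature.MathematicalPhysics.QuantumManyBody.BoseGas.periodicGroundStateEnergy v N
(Literature.MathematicalPhysics.QuantumManyBody.BoseGas.sideLength ρ N) + ENNReal.ofReal (μ * η *
N)) → ∀ ε : ℝ, 0 < ε → ∃ δ : ENNReal, 0 < δ ∧ ∀ Ψ :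
Literature.MathematicalPhysics.QuantumManyBody.BoseGas.PeriodicTrialState N
(Literature.MathematicalPhysics.QuantumManyBody.BoseGas.sideLength ρ N),
Literature.MathematicalPhysics.QuantumManyBody.BoseGas.periodicEnergy v Ψ ≤
Literature.MathematicalPhysics.QuantumManyBody.BoseGas.periodicGroundStateEnergy v N
(Literature.MathematicalPhysics.QuantumManyBody.BoseGas.sideLength ρ N) + δ → ENNReal.ofReal ((1 - η
- ε) * N) ≤ Literature.MathematicalPhysics.QuantumManyBody.BoseGas.condensateOccupation N
(Literature.MathematicalPhysics.QuantumManyBody.BoseGas.sideLength ρ N) Ψ.ψ) ∧ (∀ v : ℝ → ENNReal,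
Literature.MathematicalPhysics.QuantumManyBody.BoseGas.IsRepulsiveFiniteRange v → (∃ ρ₀ : ℝ, 0 < ρ₀
∧ ∀ ρ : ℝ, 0 < ρ → ρ < ρ₀ → ∃ c : ℝ, 0 < c ∧ ∀ᶠ N : ℕ in Filter.atTop, ∃ δ : ENNReal, 0 < δ ∧ ∀ Ψ :
Literature.MathematicalPhysics.QuantumManyBody.BoseGas.PeriodicTrialState N
(Literature.MathematicalPhysics.QuantumManyBody.BoseGas.sideLength ρ N),
Literature.MathematicalPhysics.QuantumManyBody.BoseGas.periodicEnergy v Ψ ≤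
Literature.MathematicalPhysics.QuantumManyBody.BoseGas.periodicGroundStateEnergy v N
(Literature.MathematicalPhysics.QuantumManyBody.BoseGas.sideLength ρ N) + δ → ENNReal.ofReal (c * N)
≤ Literature.MathematicalPhysics.QuantumManyBody.BoseGas.condensateOccupation N
(Literature.MathematicalPhysics.QuantumManyBody.BoseGas.sideLength ρ N) Ψ.ψ) → ∃ ρ₀ : ℝ, 0 < ρ₀ ∧ ∀
ρ : ℝ, 0 < ρ → ρ < ρ₀ → Literature.MathematicalPhysics.QuantumManyBody.BoseGas.HasGroundStateBEC v
ρ)`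

## Assembly
Pure logic plus two lines of real arithmetic, PROVED sorry-free in glue.lean / Sketch.lean (`theorem
closes (h₁ : PinnedSlopeBound) (h₂ :
SlopeToCondensation) (h₃ : BoundaryTransferWeak) : BoseEinsteinCondensation`, axioms
propext/Classical.choice/Quot.sound): fix v; h₁ gives C, ρ₀;
h₂ gives ρ₁; put ρ⋆ := 1/(16C²a³ + 1) so that η := max(C√(ρa³), 0) ≤ 1/4 for ρ < ρ⋆ (sq_le_sq); for
ρ < min(ρ₀, ρ₁, ρ⋆), eventually in N
(filter_upwards on both), the slope hypothesis of h₂ holds with this η (ofReal monotonicity), and ε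
= 1/4 yields δ with condensateOccupation ≥
(1 − η − 1/4)N ≥ N/2 on all periodic δ-near-minimisers — the periodic-BEC body with c = 1/2 — which
h₃ turns into ∃ρ₀″ ∀ρ < ρ₀″
HasGroundStateBEC v ρ, i.e. the conjunct `BoseEinsteinCondensation` (root abbrev, by name).
ClosureDefectBound, CJLSlopeBound (one line above
PinnedSlopeBound: θ = 1), HighDensityCondensation and AmplitudeEnergyIdentity sit upstream / beside
the deciding chain.

Rationale: WHY THIS LINE. Integrate the Schrödinger equation instead of squaring it (Lieb1963; Jauslin2025
§4.2): since ψ₀ ≥ 0, ν_N = ψ₀/∫ψ₀ is a probability measure on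
the torus whose correlation functions g_p (tree: `amplitudeCorrelation`) obey an EXACT LINEAR
hierarchy with the bare pair potential as its only
kernel (Jauslin2025 (4.10)), the energy is the pair-energy of ν with no kinetic term (E₀/N =
((N−1)/2V)∫v g₂, Jauslin2025 (4.6);
AmplitudeEnergyIdentity), and the CJL pin μΣ_j(1 − P_j) closes DOWNWARD, so the depletion = ∂⁺_μ
E^(μ)/N at 0⁺ is a functional of the un-closed
hierarchy; the tree's own audit of CJL-II (LiebSimpleEquationPinned.lean: no pinned solution for μ <
0, η is a RIGHT derivative) is built into
every statement here (μ > 0 only). Lieb CLOSED the hierarchy by superposition (Jauslin2025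
Assumption 4.1) and Carlen–Jauslin–Lieb proved that
the closed simple equation has a unique solution (CarlenJauslinLieb2020 Thm 1, PROVED in tree as
CarlenJauslinLieb2020_thm1_holds) with the LHY
energy, the mean-field energy at high density, u ≍ |x|⁻⁴ and a closed formula for η with η ∼
8√(ρa³)/(3√π) (CarlenJauslinLieb2021 Thms 2, 6),
writing that validity of the closure "would imply BEC in the thermodynamic limit"; Jauslin2025 §8.1
names bounding g₃, g₄ minus their
factorised counterparts as the open problem — ClosureDefectBound is that problem with a rate. The
route treats the UN-CLOSED pinned hierarchy as
a linear fixed-point problem for the truncated correlations (h₃, h₄ = tree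
`truncatedCorrelation3/4`) around the CJL solution, driven by CJL's
already-inverted massless operator 𝔎_e — importing Kirkwood–Salsburg / Ruelle1969 Banach fixed-point
technology for LINEAR correlation
hierarchies from classical statistical mechanics and the diagnosis that the closure error is a
truncated correlation of a temperature-2 Riesz-2
gas with r⁻⁴ tails (perfect screening ρ∫u = 1, CarlenJauslinLieb2021) — and it calibrates at HIGH
density for bounded positive-type v, where
Born, closure and CJL's e are simultaneously asymptotically exact (Lieb1963; CarlenJauslinLieb2020
Thm 2; GiulianiSeiringer2009 energy only).
Versus prior routes: no plane-wave infrared bound (BECInfraredBound), no κ/L² pinned-energy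
comparison (BECPinning: here μ is O(1) and only the
slope at 0⁺ is used), no RG (BECRenormGroup), no Born-measure landscape (BECPalmLandscape), no
density-chord shape hypothesis (BECDensityChord);
it plugs into BECPeriodicReduction through the shared BoundaryTransferWeak. Negatives index: 6
refuted statements, the only BEC one
(SwapJensen, stmt-3980) concerns a Jensen step for swap affinities — not used.

RANKED CRUXES. #2 ClosureDefectBound (crux) — (card C1, AMPLITUDE-GAS CLUSTERING, typed with the
landed AmplitudeCorrelation defs) for bounded repulsive finite-range v there are C, ρ₀ such that for
0 < ρ < ρ₀ there is μ₀ > 0 with, eventually in N, for every pin μ ∈ [0, μ₀], some δ > 0 such that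
every NON-NEGATIVE periodic trial state on the torus of side L = (N/ρ)^(1/3) that is a
δ-near-minimiser of the pinned functional ⟨Ψ,HΨ⟩ + μ(N − ⟨Ψ,n₀Ψ⟩) has level-2 closure defects small
in v-weighted L¹: ∫_(cell²) |D₃ + D₄| dx₁dx₂ ≤ C√(ρa³)·‖v‖₁·L³, where D₃(x₁,x₂) = ρΣ_(i=1,2)∫_cell
v^per(x_i − y) h₃(x₁,x₂,y) dy (h₃ = g₃ − Kirkwood superposition, `truncatedCorrelation3`) and
D₄(x₁,x₂) = (ρ²/2)∫∫_(cell²) v^per(y − y′) h₄(x₁,x₂,y,y′) dy dy′ (h₄ = g₄ − Lieb's level-4 closure,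
`truncatedCorrelation4`) are exactly the terms by which the exact level-2 equation of Lieb's
hierarchy (Jauslin2025 (4.10), p = 2) differs from Lieb's closed "big equation". Scale check: h₃ at
separation r ~ ξ is O(u(ξ)²) = O(ρa³) pointwise but integrates over the correlation volume ρξ³ =
(ρa³)^(−1/2) to the relative size √(ρa³) = ε of the retained terms ρ∫v g₃ ~ ‖v‖₁ρ per unit volume; v
≡ 0 gives 0 ≤ 0. [difficulty: open-problem] (why it might fail: Infinite-volume
truncated-correlation bound for a long-range (r⁻⁴-tailed) gas, uniform in N, without a priori access
to ψ₀; Beliaev/3-body infrared physics lives in h₃ (possible ε·log ε); d = 1 closure off by 19–69%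
(LiebLiniger1964); near-minimiser form needs fixed-N H¹→L³ spike control.) [Lieb1963, Jauslin2025,
CarlenJauslinLieb2021, CarlenEtAl2021, LiebLiniger1964]
#3 CJLSlopeBound (crux) — (card C2 OUTPUT, the un-closed hierarchy contracted around CJL; sharp
form) for every repulsive finite-range radial v and every θ > 0 there is ρ₀ > 0 such that for 0 < ρ
< ρ₀, eventually in N, for EVERY μ > 0: inf over periodic trial states of [periodicEnergy v Ψ + μ(N
− condensateOccupation Ψ)] ≤ periodicGroundStateEnergy + μ·(8/(3√π) + θ)·√(ρa³)·N, a =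
scatteringLength v. By concavity of μ ↦ E^(μ) (an infimum of affine functions) this is the statement
that the right slope at 0⁺ — the torus ground state's depletion fraction — is at most Bogoliubov's
(8/(3√π) + o(1))√(ρa³), the constant the simple equation reproduces (CarlenJauslinLieb2021 Thm 6: η
∼ 8√(ρa³)/(3√π); in tree the faithful reading is the asymptotics of `etaFormula`,
LiebSimpleEquationPinned.lean). Intended proof = the card's engine: rewrite the exact pinned
hierarchy for (h_p)_(p≥3) around the pinned CJL solution, solve it as a Banach fixed point in an
r⁻⁴-clustering class driven by 𝔎_e = (−Δ + v + 4e(1 − ρu∗))⁻¹ (CarlenJauslinLieb2021 (1.7), Lemma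
1.10), prove the true g_p lie in the class (ClosureDefectBound + growth in p), and transfer C¹-in-μ;
then AmplitudeEnergyIdentity turns g₂^(μ) into E^(μ). v ≡ 0: a = 0 and the constant state gives
equality. [deps: ClosureDefectBound] [difficulty: open-problem] (why it might fail: Asserts
Bogoliubov's depletion constant as an asymptotic UPPER bound in the TL — open beyond boxes of side
a(ρa³)^(−3/4−η) (Junge2026); needs C¹-in-μ (not C⁰) closeness to CJL: an O(ε)-absolute closure error
in the μ-derivative kills the sharp constant, leaving only ∃C.) [CarlenJauslinLieb2021,
CarlenJauslinLieb2020, BoccatoEtAl2019Acta, Lieb1963, Jauslin2025, Junge2026, Ruelle1969]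
#4 PinnedSlopeBound (crux) — (card C2 output node, what BEC needs) for every repulsive finite-range
radial v there are C and ρ₀ > 0 such that for 0 < ρ < ρ₀, eventually in N, for every μ > 0: inf over
periodic trial states Ψ on the torus of side L = (N/ρ)^(1/3) of [periodicEnergy v Ψ + μ(N −
condensateOccupation Ψ)] ≤ periodicGroundStateEnergy v N L + μ·C√(ρa³)·N, a = scatteringLength v.
Equivalent by concavity to the same for μ ∈ (0, μ₀]; equivalent, given SlopeToCondensation's
spectral input, to ground-state depletion ≤ C√(ρa³)N. One-line corollary of CJLSlopeBound (θ = 1);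
expected C → 8/(3√π) = 1.5045. Sanity: v ≡ 0 gives 0 ≤ 0 (the constant state has
condensateOccupation exactly N); hard cores consistent (every finite-energy Ψ has depletion ≥
(π/6)ρR₀³N ≪ √(ρa³)N). [deps: CJLSlopeBound] [difficulty: open-problem] (why it might fail: It IS TL
ground-state BEC at Bogoliubov rate on the torus (open: "still not within reach", Junge2026,
ChongLiangNam2026); the amplitude-gas route to it needs #2 + the contraction behind #3, whose
linked-cluster reorganisation may not converge (r⁻⁴ tails, d = 3 logs via h₃).)
[CarlenJauslinLieb2021, CarlenJauslinLieb2020, Lieb1963, Jauslin2025, LSSY2005, FournaisSolovej2020,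
Junge2026, ChongLiangNam2026]
#5 HighDensityCondensation (crux) — (card target HighDensityTLBEC, the dense-first calibration rung;
deliberately outside the deciding chain) for every BOUNDED, POSITIVE-TYPE (Σ_(x,y∈s) w_x w_y
v(|x−y|) ≥ 0 for all finite s ⊂ ℝ³ and real weights w), repulsive finite-range radial v there is ρ₁
such that for every ρ > ρ₁ there is c > 0 with: eventually in N there is δ > 0 such that every
periodic trial state on the torus of side (N/ρ)^(1/3) with periodicEnergy ≤ E₀^per + δ has
condensateOccupation ≥ cN. This is the density axis on which the Born approximation (a ≈ a₀), Lieb's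
bounds ρv̂(0)/2 − v(0)/2 ≤ e ≤ ρv̂(0)/2 and the CJL closure are simultaneously asymptotically exact,
and where Bogoliubov predicts a depletion FRACTION O(ρ^(−1/2)) (up to logs) → 0; class member: v =
χ_B ∗ χ_B (autocorrelation of a ball indicator: bounded, non-negative, finite range, positive type).
[difficulty: open-problem] (why it might fail: No TL-BEC theorem exists at ANY density; at fixed
coupling ρξ³ = ρ^(−1/2)v̂(0)^(−3/2) → 0 (under one particle per healing volume), so Bogoliubov's
validity parameter fails even though ρ^(2/3) ≫ v(0) forbids a crystal; positive type is essential
(v̂(k₀) < 0: density wave / cluster crystal).) [Lieb1963, CarlenJauslinLieb2020,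
GiulianiSeiringer2009, Seiringer2011, CarlenEtAl2021, LSSY2005]
#6 SlopeToCondensation (crux) — (fixed-N Hellmann–Feynman transfer, card C3) for every repulsive
finite-range v there is ρ₁ > 0 such that for 0 < ρ < ρ₁, eventually in N, for every real η ≥ 0: if
for all μ > 0 the pinned infimum is ≤ E₀^per + μηN, then for every ε > 0 there is δ > 0 such that
every periodic δ-near-minimiser has condensateOccupation ≥ (1 − η − ε)N. Proof shape: E₀^per < ⊤ at
low density (hard cores: symmetrised lattice trial state); H + μN₊ has compact resolvent and, for μ
≥ 0, a positivity-improving semigroup (e^(tμΣP_j) has a non-negative kernel), hence a unique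
positive gapped ground state ψ₀; second-order perturbation E^(μ) ≥ E₀ + μ⟨N₊⟩₀ − c_N μ² gives ⟨N₊⟩₀
≤ ηN; near-minimisers are L²-close to ψ₀ by the gap and √occupation is √N-Lipschitz in L².
[difficulty: M] (why it might fail: v = ⊤ shells or hard cores disconnect configuration space; with
a degenerate ground space ∂⁺_μE^(μ)(0) is the MINIMUM depletion over ground states, so the slope
certifies only the best ground state while near-minimisers reach the worst (low-density hard-sphere
connectivity is open).) [CarlenJauslinLieb2021, ReedSimonIV1978, BaryshnikovBubenikKahle2013,
LSSY2005]
#7 BoundaryTransferWeak (crux) — (shared verbatim with route BECPeriodicReduction,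
stmt-AtomisticToContinuum-0827) for each repulsive finite-range v, periodic constant-mode BEC of
near-minimisers at all small densities implies ∃ρ₀ > 0 ∀ρ ∈ (0, ρ₀) HasGroundStateBEC v ρ (Dirichlet
box, mode-free λ_max criterion via condensateNumber). Not glue: near-minimiser slacks are O(N/L²)
while Dirichlet/periodic energies differ by a boundary term ≫ N/L², so no energy-comparison proof;
expected route: Neumann bracketing of interior sub-boxes plus a mode-free criterion; the 2026
Neumann localisation with a gap (Junge2026) and the Poincaré-type kinetic localisation
(ChongLiangNam2026) are the nearest tools. [difficulty: L] (why it might fail: The Dirichlet ground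
state lies a wall term ≫ the near-minimiser slack N/L² above E₀^per and interior restrictions are
neither periodic nor of sharp N, so the periodic hypothesis may never fire; only the ENERGY transfer
is in print (Robinson1976).) [LSSY2005, Robinson1976, BoccatoSeiringer2023, Junge2026]
#9 AmplitudeEnergyIdentity (support) — (Lieb's starting identity, pinned version; card C3) for
bounded repulsive finite-range v, N, L > 0, μ ≥ 0 and ε > 0 there is δ > 0 such that every
NON-NEGATIVE periodic trial state Ψ that is a δ-near-minimiser of the pinned functional
periodicEnergy + μ(N − condensateOccupation) satisfies |E^(μ)(N,L)·∫_(cell^N)Ψ − ∫_(cell^N)(Σ_(i<j)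
v^per(x_i − x_j))Ψ| ≤ ε∫_(cell^N)Ψ (two ENNReal inequalities): the pinned energy is the pair-energy
of the amplitude gas, E^(μ)/N = ((N−1)/2V)∫v^per g₂^(μ), with NO kinetic and NO pinning term (⟨1,
Δψ⟩ = 0 on the torus and ⟨1, (1 − P_j)ψ⟩ = 0: the pin closes downward). Proof: uniqueness and
positivity of the pinned ground state for μ ≥ 0, L²-convergence of near-minimisers on the finite
cell (their overlap with ψ₀ controls ∫Ψ since ∫ψ₀ > 0), ⟨1, H^(μ)ψ₀⟩ = E^(μ)⟨1, ψ₀⟩ with v^per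
bounded; the functional is LINEAR in the amplitude gas, so no spike control is needed. [difficulty:
M] [Lieb1963, Jauslin2025, CarlenJauslinLieb2021, ReedSimonIV1978]

TWO-LAYER PLAN. Foreseen, nothing filed now: CJLSlopeBound ⇐ ClosureDefectBound →
HierarchyFixedPoint → CJLSlopeBound, where HierarchyFixedPoint (typed with
the landed LiebSimpleEquation objects: IsPinnedSolution (halfProfile v), keApply, etaFormula) =
existence, uniqueness-in-class and C¹-in-μ
transfer for the exact pinned hierarchy rewritten for (h_p)_(p≥3) around the pinned CJL solution,
with the corrected CJL-II Thm 6 (etaFormula ∼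
8√(ρa³)/(3√π), right derivative; cite item to be filed) consumed as `(h : Fact) →`; PinnedSlopeBound
⇐ CJLSlopeBound (θ = 1, one line) or, for
bounded v, ⇐ AmplitudeEnergyIdentity → ContactValueSlope (the pin changes the amplitude gas's
contact value ∫v^per g₂ by ≤ μC√(ρa³) per particle)
→ PinnedSlopeBound, hard cores by a HardCoreTruncation child (v∧M ↑ v at fixed N);
HighDensityCondensation ⇐ HighDensitySlope (PinnedSlopeBound's
analogue with rate C(ρR₀³)^(−1/2)) → SlopeToCondensationDense (bounded v, no low-density guard,
provable now) → HighDensityCondensation;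
SlopeToCondensation ⇐ FiniteEnergyLowDensity → UniqueGappedPinnedGroundState → SlopeToCondensation.

KILL CRITERIA. Flat-trial PIGS (end slice = ψ₀/∫ψ₀ exactly) at ρa³ ∈ {10⁻³, 10⁻²}, v = e^(−|x|): a
v-weighted L¹ closure defect ∫|D₃ + D₄| of relative size
O(1) instead of O(√(ρa³)) refutes ClosureDefectBound — close `refuted:ClosureDefectBound` unless the
defect is SIGNED (then pivot to a conditional
one-sided route). A theorem that the true torus depletion exceeds (8/(3√π) + θ)√(ρa³)N at
arbitrarily small ρ refutes CJLSlopeBound only (pivot: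
keep PinnedSlopeBound with ∃C and re-type the contraction's output two-sidedly around etaFormula);
¬PinnedSlopeBound (no √(ρa³) rate at all)
kills the whole amplitude-gas line. ¬SlopeToCondensation through degenerate torus ground states of
an admissible v at arbitrarily low density
breaks this frame and every near-minimiser frame (conjunct-level) — pivot: bounded v plus a
HardCoreTruncation item. ¬BoundaryTransferWeak kills
the route (shared with BECPeriodicReduction), not the conjunct. ¬HighDensityCondensation (a
density-wave or crystalline torus ground state for some
bounded positive-type v at high density) removes the calibration rung; the low-density line
survives. PeriodicBEC (stmt-0826) or X_B1 proved
elsewhere moots PinnedSlopeBound's role; the route then lives on as ClosureDefectBound +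
CJLSlopeBound (the sharp constant) and HighDensityCondensation.

NOT DECOMPOSED YET. The Banach space of the contraction (weights (1+|x|/ξ)⁴-type, growth in p as
activity bounds for Kirkwood–Salsburg, Moraal) and the μ-increment
(C¹) bounds on the defects — HierarchyFixedPoint, a layer-2 child of CJLSlopeBound; the finite-N
O(p/N) terms of the exact hierarchy versus the
infinite-volume operator; the exponential SENSITIVITY of the amplitude gas to L²-perturbations (∫ψ₀
= V^(N/2)e^(−cN): near-minimiser statements
are true/false according to ψ₀ only because δ is chosen after N; nonlinear closure functionals need
the fixed-N H¹ → L³ Sobolev control in the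
pair variables) — a `--supports` lemma of ClosureDefectBound; hard cores (monotone truncation;
CarlenJauslinLieb2020 §6) and E₀^per < ⊤; the
spectral package behind SlopeToCondensation and AmplitudeEnergyIdentity (compact resolvent,
Perron–Frobenius for H + μN₊, first-order
perturbation); the high-density slope statement and its rate; the passage simple → big → complete
equation inside the contraction; nothing on T >
0, and nothing on the Dirichlet box beyond BoundaryTransferWeak.

CHEAPEST FALSIFIER. (i) Lookup, done 2026-08-15: un-closed-hierarchy control, a TL depletion bound
with Bogoliubov's constant, or TL-BEC at high density in print?
CarlenJauslinLieb2021 §1, Jauslin2025 §8.1 (open), Junge2026 / ChongLiangNam2026 (BEC only on boxes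
of side ≲ a(ρa³)^(−3/4−η)),
GiulianiSeiringer2009 (energy only) — no. (ii) Consistency, by hand and
against the tree: v ≡ 0 makes every typed item true with equality (constant state: E^(μ) = E₀ = 0,
condensateOccupation = N, a = 0, defects 0;
SlopeToCondensation via the free gap (2π/L)²); the tree's audit of CJL-II
(LiebSimpleEquationPinned.lean: no pinned solution for μ < 0, η a
right derivative; Thm 3 misstated; Thm 2's printed β off by 3) touches no item (all use μ > 0 and no
printed CJL constant except Bogoliubov's
8/(3√π)); 1-D transplant: LiebLiniger1964 found the closure's energy off by 19–69% — it fails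
exactly where there is no BEC. (iii) Decisive cheap
test, not runnable here (hub compute-free): flat-trial PIGS closure defect ∫|D₃ + D₄|/(‖v‖₁L³) at
ρa³ ∈ {10⁻³, 10⁻²} and ρR₀³ ∈ {10, 100} for
v = e^(−|x|) (CarlenEtAl2021's potential); O(1) instead of O(√(ρa³)) retires the card.

NUMBERS. η_Bog = (8/(3√π))√(ρa³) = 1.5045√(ρa³) (CarlenJauslinLieb2021 Thm 6: the simple equation
reproduces it; BoccatoEtAl2019Acta: proved in the
Gross–Pitaevskii regime); e = 2πρa(1 + (128/(15√π))√(ρa³) + o) in CJL units −½Δ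
(CarlenJauslinLieb2020 Thm 2; FournaisSolovej2020, YauYin2009 for
the gas), = 4πρa(…) in ours (e_ours(v) = 2e_CJL(v/2), tree `halfProfile`); ρu(x) =
√(2+β/3)/(2π²√e)|x|⁻⁴ + R (CarlenJauslinLieb2021 Thm 2 as
CORRECTED in tree, `correctedDecayCoeff`); ∫u = 1/ρ exactly (tree theorem `IsSolution.integral_eq`;
"not a low-density model", Jauslin2025
§8.1); high density: e = (ρ/2)∫v + o(ρ) (CarlenJauslinLieb2020 Thm 2) and Lieb1963's bounds ρv̂(0)/2
− v(0)/2 ≤ e ≤ ρv̂(0)/2 for positive-type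
v; closure numerics: energy within 5% of QMC at all densities for v = e^(−|x|)
(CarlenJauslinLieb2020 §5.2, CarlenEtAl2021), 1-D 19–69%
(LiebLiniger1964); BEC length scales in print: L = C(ρa³)^(−δ)(ρa)^(−1/2) periodic (Fournais2020), R
∼ a(ρa³)^(−3/4−η) Neumann at T ∼ ρa
(Junge2026); GiulianiSeiringer2009 Thm 1: e at high density for positive-definite v, energy only.
Items at open: 8 (6 typed cruxes incl. 1
shared, 1 support, 1 assembly); 0 informal items; 0 definition requests (both gen-1 requests
landed); 1 cite request to file (corrected CJL-II Thm 6).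

DEFINITION REQUESTS. None outstanding: defn-AmplitudeCorrelation (done: `amplitudeCorrelation`,
`pairCorrelation`, `truncatedCorrelation3/4`, `liebClosure3/4`,
`amplitudeExpectation`, marginal rule (4.13)) and defn-LiebSimpleEquation (landed:
`LiebSimpleEquation.IsSolution`, `IsPinnedSolution`,
`pinnedEnergy`, `keApply`, `etaFormula`, `halfProfile`; `CarlenJauslinLieb2020_thm1_holds` proved)
cover every typed item and the foreseen
layer-2 child. Cite fact wanted (to be filed as `--kind cite` right after open, consumer = the
CJLSlopeBound split): CJL-II Theorem 6 in its
CORRECTED reading recorded in LiebSimpleEquationPinned.lean — (a) along a differentiable branch μ ↦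
(e_μ, u_μ), μ ≥ 0, of pinned solutions the
right derivative at 0 is `etaFormula 𝒱 ρ e u`; (b) etaFormula ∼ 8√(ρa₀³)/(3√π) uniformly over
solution triples as ρ → 0 (CarlenJauslinLieb2021
Thm 6, §5 (eta_asym)). No new notion is needed (PeriodicTrialState, periodicEnergy,
periodicGroundStateEnergy, condensateOccupation,
periodicInteraction, periodizedPotential, cell, cellN, sideLength, scatteringLength,
HasGroundStateBEC all exist in
Literature.MathematicalPhysics.QuantumManyBody.BoseGas).

Novelty: Searches (2026-08-15, this seat, on top of the card's audit-12/28/30/36 and the gen-1 route's list):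
`lit frontier AtomisticToContinuum --since
2022` (30 rows; BEC descendants arXiv:2603.20776 = Junge2026, arXiv:2510.20493 = ChongLiangNam2026,
arXiv:2602.16566, arXiv:2605.06844 — none on
the simplified approach; both BEC papers read pp. 1–2: "thermodynamic limit still not within
reach"); `lit citing arXiv:2010.13882` (7:
arXiv:2302.13446, arXiv:2202.07637, arXiv:2203.11917, arXiv:2002.04184 + 3 unresolved); `lit citing
arXiv:2308.00290` (0); `lit search --source
crossref "simplified approach Bose gas hierarchy closure Jauslin 2025" --year-from 2024` (12:
doi:10.1007/978-3-031-81393-1 and its chapters incl.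
_8 Open Problems, doi:10.1007/s10955-024-03299-4); `lit search --source crossref "number of excited
particles dilute Bose gas thermodynamic
limit bound"` (10, none relevant beyond 2-D free-energy papers doi:10.1017/fms.2020.17); `lit search
--source arxiv|zbmath "condensate depletion …
thermodynamic limit Bogoliubov bound"` (0, 0); `lit galaxy search "Kirkwood superposition
approximation" --star all` (20: classical-liquid
books panama:286293930016799 Kjellander, panama:438009354780684 Cole, PhysRevB.22.206 three-particle
distribution in liquid ⁴He — heuristic KSA
tests for BORN measures); `lit galaxy search "simplified approach to the Bose gas" --star all` (1:
Rougerie's EMS survey, unrelated); searchd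
hybrid rc 75 and OpenAlex 429 in this pass (recorded, no claim rests on  [refs: 10.1007/978-3-031-81393-1, 10.1007/s10955-024-03299-4, 10.1017/fms.2020.17, 10.1007/978-3-031-81393-1_8:, 10.1103/physrevb.22.206, 2603.20776, 2510.20493, 2602.16566, 2605.06844, 2010.13882, 2302.13446, 2202.07637, 2203.11917, 2002.04184, 2308.00290, 0811.1166, doi:10.1007/978-3-031-81393-1, doi:10.1007/s10955-024-03299-4, doi:10.1017/fms.2020.17, doi:10.1007/978-3-031-81393-1_8, doi:10.1103/physr]

Barriers (technique_class: linear-hierarchy amplitude-measure fixed-point clustering): - technique_class: linear-hierarchy amplitude-measure fixed-point clustering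
- Literature.Barriers.AtomisticToContinuum.EnergyAsymptoticsWithoutCondensation: evaded — no energy
asymptotics of e(ρ) are matched to infer BEC; the energy enters only as the μ-SLOPE of the pinned
family at 0⁺, which at finite N IS the depletion (SlopeToCondensation), and the 1-D witness is
respected (LiebLiniger1964: the closure fails by 19–69% exactly where there is no BEC).
- Literature.Barriers.AtomisticToContinuum.EnergyAsymptoticsWithoutCondensationNarrow: same; nothing
here uses LHY-precision VALUES of E₀ (the recorded C⁰ pitfall: values of E^(μ) give only lower
bounds on depletion by concavity — every slope item is first-order in μ).
- Literature.Barriers.AtomisticToContinuum.SymmetryBreakingWithoutCondensate: respected — the pin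
μΣ_j(1 − P_j) is number-conserving (no gauge-breaking source) and only the RIGHT derivative at μ =
0⁺ at finite N is used; the tree's audit (no pinned CJL solution for μ < 0) confirms that only μ > 0
is meaningful, and every item quantifies μ > 0 (or μ ∈ [0, μ₀] for the static clustering bound).
- Literature.Barriers.AtomisticToContinuum.SymmetryBreakingWithoutCondensateNarrow: cubes only (L =
(N/ρ)^(1/3)), canonical, T = 0 — outside the anisotropic-box witnesses.
- Literature.Barriers.AtomisticToContinuum.BogoliubovPerturbationInfrared: not in its class at the
linear level — the massless linear-dispersion operator (symbol k² + 4e(1 − ρû(k)) ≍ c|k| + k²) is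
INVERTED

History (route lifecycle, newest last):
- 2026-08-24T23:41:07Z · DORMANT — reconciler: no traction for 7.2 d (last activity item-evidence-added at 2026-08-17T18:55:01Z); parked, not closed — `ledger route dormant route-AtomisticToConti (operator:999:966616)
- 2026-08-29T03:11:28Z · REACTIVATED — reconciler: reactivated — activity statement-checked at 2026-08-29T01:17:37Z after parking at 2026-08-24T23:41:07Z (operator:999:3192537)
- 2026-08-29T19:24:42Z · DORMANT — census g0: costume|duplicate of —; reader census-reader-31-g0 (operator:999:710173)

sub-problem: BoseEinsteinCondensation · status: dormant · opened planner-plancard-AtomisticToContinuum-BoseEin-43545e8e-g2-0 2026-08-15T18:57:08Z · rev 2 · ledger route-AtomisticToContinuum-BECAmplitudeGas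
GENERATED by the gate from the ledger (D-0016/17). Provers cite these decls: `theorem foo : Summit.AtomisticToContinuum.BoseEinsteinCondensation.Theses.BECAmplitudeGas.<Decl> := …` in Summits/AtomisticToContinuum/BoseEinsteinCondensation/Theorems/<Name>.lean.
-/

namespace Summit.AtomisticToContinuum.BoseEinsteinCondensation.Theses.BECAmplitudeGas

open scoped BigOperators Topology Manifold Classical MeasureTheory ProbabilityTheory Matrix InnerProductSpace ComplexConjugate ContinuousMap
open Filter Set Function TopologicalSpace MeasureTheory

attribute [summit_statement] _root_.BoseEinsteinCondensation

/-- item stmt-AtomisticToContinuum-13025 · crux · rank 2 · open · by planner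
why it might fail: Infinite-volume truncated-correlation bound for a long-range (r⁻⁴-tailed) gas, uniform in N, without a priori access to ψ₀; Beliaev/3-body infrared physics lives in h₃ (possible ε·log ε); d = 1 closure off by 19–69% (LiebLiniger1964); near-minimiser form needs fixed-N H¹→L³ spike control.
sources: Lieb1963, Jauslin2025, CarlenJauslinLieb2021, CarlenEtAl2021, LiebLiniger1964, arXiv:2308.00290
[crux] (card C1, AMPLITUDE-GAS CLUSTERING, typed with the landed AmplitudeCorrelation defs) for
bounded repulsive finite-range v there are C, ρ₀ such that for 0 < ρ < ρ₀ there is μ₀ > 0 with,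
eventually in N, for every pin μ ∈ [0, μ₀], some δ > 0 such that every NON-NEGATIVE periodic trial
state on the torus of side L = (N/ρ)^(1/3) that is a δ-near-minimiser of the pinned functional
⟨Ψ,HΨ⟩ + μ(N − ⟨Ψ,n₀Ψ⟩) has level-2 closure defects small in v-weighted L¹: ∫_(cell²) |D₃ + D₄|
dx₁dx₂ ≤ C√(ρa³)·‖v‖₁·L³, where D₃(x₁,x₂) = ρΣ_(i=1,2)∫_cell v^per(x_i − y) h₃(x₁,x₂,y) dy (h₃ = g₃
− Kirkwood superposition, `truncatedCorrelation3`) and D₄(x₁,x₂) = (ρ²/2)∫∫_(cell²) v^per(y − y′)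
h₄(x₁,x₂,y,y′) dy dy′ (h₄ = g₄ − Lieb's level-4 closure, `truncatedCorrelation4`) are exactly the
terms by which the exact level-2 equation of Lieb's hierarchy (Jauslin2025 (4.10), p = 2) differs
from Lieb's closed "big equation". Scale check: h₃ at separation r ~ ξ is O(u(ξ)²) = O(ρa³)
pointwise but integrates over the correlation volume ρξ³ = (ρa³)^(−1/2) to the relative size √(ρa³)
= ε of the retained terms ρ∫v g₃ ~ ‖v‖₁ρ per unit volume; v ≡ 0 gives 0 ≤ 0. [difficulty:
open-problem] -/
@[route_item "route-AtomisticToContinuum-BECAmplitudeGas"]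
def ClosureDefectBound : Prop :=
  ∀ v : ℝ → ENNReal, Literature.MathematicalPhysics.QuantumManyBody.BoseGas.IsRepulsiveFiniteRange v → (∃ M : NNReal, ∀ r : ℝ, v r ≤ (M : ENNReal)) → ∃ C ρ₀ : ℝ, 0 < ρ₀ ∧ ∀ ρ : ℝ, 0 < ρ → ρ < ρ₀ → ∃ μ₀ : ℝ, 0 < μ₀ ∧ ∀ᶠ N : ℕ in Filter.atTop, ∀ μ : ℝ, 0 ≤ μ → μ ≤ μ₀ → ∃ δ : ENNReal, 0 < δ ∧ ∀ Ψ : Literature.MathematicalPhysics.QuantumManyBody.BoseGas.PeriodicTrialState N (Literature.MathematicalPhysics.QuantumManyBody.BoseGas.sideLength ρ N), (∀ X, Ψ.ψ X = (‖Ψ.ψ X‖ : ℂ)) → Literature.MathematicalPhysics.QuantumManyBody.BoseGas.periodicEnergy v Ψ + ENNReal.ofReal μ * ((N : ENNReal) - Literature.MathematicalPhysics.QuantumManyBody.BoseGas.condensateOccupation N (Literature.MathematicalPhysics.QuantumManyBody.BoseGas.sideLength ρ N) Ψ.ψ) ≤ (⨅ Φ : Literature.MathematicalPhysics.QuantumManyBody.BoseGas.PeriodicTrialState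 N (Literature.MathematicalPhysics.QuantumManyBody.BoseGas.sideLength ρ N), Literature.MathematicalPhysics.QuantumManyBody.BoseGas.periodicEnergy v Φ + ENNReal.ofReal μ * ((N : ENNReal) - Literature.MathematicalPhysics.QuantumManyBody.BoseGas.condensateOccupation N (Literature.MathematicalPhysics.QuantumManyBody.BoseGas.sideLength ρ N) Φ.ψ)) + δ → ∫ x in Literature.MathematicalPhysics.QuantumManyBody.BoseGas.cellN 2 (Literature.MathematicalPhysics.QuantumManyBody.BoseGas.sideLength ρ N), |ρ * (∫ y in Literature.MathematicalPhysics.QuantumManyBody.BoseGas.cell (Literature.MathematicalPhysics.QuantumManyBody.BoseGas.sideLength ρ N), ((Literature.MathematicalPhysics.QuantumManyBody.BoseGas.periodizedPotential v (Literature.MathematicalPhysics.QuantumManyBody.BoseGas.sideLength ρ N) (x 0 - y)).toReal + (Literature.MathematicalPhysics.QuantumManyBody.BoseGas.periodizedPotential v (Literature.MathematicalPhysics.QuantumManyBody.BoseGas.sideLength ρ N) (x 1 - y)).toReal) * Literature.MathematicalPhysics.QuantumManyBody.BoseGas.truncatedCorrelation3 N (Literature.MathematicalPhysics.QuantumManyBody.BoseGas.sideLength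 ρ N) Ψ.ψ ![x 0, x 1, y]) + ρ ^ 2 / 2 * (∫ y in Literature.MathematicalPhysics.QuantumManyBody.BoseGas.cell (Literature.MathematicalPhysics.QuantumManyBody.BoseGas.sideLength ρ N), ∫ y' in Literature.MathematicalPhysics.QuantumManyBody.BoseGas.cell (Literature.MathematicalPhysics.QuantumManyBody.BoseGas.sideLength ρ N), (Literature.MathematicalPhysics.QuantumManyBody.BoseGas.periodizedPotential v (Literature.MathematicalPhysics.QuantumManyBody.BoseGas.sideLength ρ N) (y - y')).toReal * Literature.MathematicalPhysics.QuantumManyBody.BoseGas.truncatedCorrelation4 N (Literature.MathematicalPhysics.QuantumManyBody.BoseGas.sideLength ρ N) Ψ.ψ ![x 0, x 1, y, y'])| ≤ C * Real.sqrt (ρ * (Literature.MathematicalPhysics.QuantumManyBody.BoseGas.scatteringLength v).toReal ^ 3) * (∫ z : Literature.MathematicalPhysics.QuantumManyBody.BoseGas.Space, (v ‖z‖).toReal) * Literature.MathematicalPhysics.QuantumManyBody.BoseGas.sideLength ρ N ^ 3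

/-- item stmt-AtomisticToContinuum-13026 · crux · rank 3 · open · by planner
why it might fail: Asserts Bogoliubov's depletion constant as an asymptotic UPPER bound in the TL — open beyond boxes of side a(ρa³)^(−3/4−η) (Junge2026); needs C¹-in-μ (not C⁰) closeness to CJL: an O(ε)-absolute closure error in the μ-derivative kills the sharp constant, leaving only ∃C.
sources: CarlenJauslinLieb2021, CarlenJauslinLieb2020, BoccatoEtAl2019Acta, Lieb1963, Jauslin2025, Junge2026
[crux] (card C2 OUTPUT, the un-closed hierarchy contracted around CJL; sharp form) for every
repulsive finite-range radial v and every θ > 0 there is ρ₀ > 0 such that for 0 < ρ < ρ₀, eventually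
in N, for EVERY μ > 0: inf over periodic trial states of [periodicEnergy v Ψ + μ(N −
condensateOccupation Ψ)] ≤ periodicGroundStateEnergy + μ·(8/(3√π) + θ)·√(ρa³)·N, a =
scatteringLength v. By concavity of μ ↦ E^(μ) (an infimum of affine functions) this is the statement
that the right slope at 0⁺ — the torus ground state's depletion fraction — is at most Bogoliubov's
(8/(3√π) + o(1))√(ρa³), the constant the simple equation reproduces (CarlenJauslinLieb2021 Thm 6: η
∼ 8√(ρa³)/(3√π); in tree the faithful reading is the asymptotics of `etaFormula`,
LiebSimpleEquationPinned.lean). Intended proof = the card's engine: rewrite the exact pinned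
hierarchy for (h_p)_(p≥3) around the pinned CJL solution, solve it as a Banach fixed point in an
r⁻⁴-clustering class driven by 𝔎_e = (−Δ + v + 4e(1 − ρu∗))⁻¹ (CarlenJauslinLieb2021 (1.7), Lemma
1.10), prove the true g_p lie in the class (ClosureDefectBound + growth in p), and transfer C¹-in-μ;
then AmplitudeEnergyIdentity turns g₂^(μ) into E^(μ). v ≡ 0: a = -/
@[route_item "route-AtomisticToContinuum-BECAmplitudeGas"]
def CJLSlopeBound : Prop :=
  ∀ v : ℝ → ENNReal, Literature.MathematicalPhysics.QuantumManyBody.BoseGas.IsRepulsiveFiniteRange v → ∀ θ : ℝ, 0 < θ → ∃ ρ₀ : ℝ, 0 < ρ₀ ∧ ∀ ρ : ℝ, 0 < ρ → ρ < ρ₀ → ∀ᶠ N : ℕ in Filter.atTop, ∀ μ : ℝ, 0 < μ → (⨅ Ψ : Literature.MathematicalPhysics.QuantumManyBody.BoseGas.PeriodicTrialState N (Literature.MathematicalPhysics.QuantumManyBody.BoseGas.sideLength ρ N), Literature.MathematicalPhysics.QuantumManyBody.BoseGas.periodicEnergy v Ψ + ENNReal.ofReal μ * ((N : ENNReal) -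 Literature.MathematicalPhysics.QuantumManyBody.BoseGas.condensateOccupation N (Literature.MathematicalPhysics.QuantumManyBody.BoseGas.sideLength ρ N) Ψ.ψ)) ≤ Literature.MathematicalPhysics.QuantumManyBody.BoseGas.periodicGroundStateEnergy v N (Literature.MathematicalPhysics.QuantumManyBody.BoseGas.sideLength ρ N) + ENNReal.ofReal (μ * ((8 / (3 * Real.sqrt Real.pi) + θ) * Real.sqrt (ρ * (Literature.MathematicalPhysics.QuantumManyBody.BoseGas.scatteringLength v).toReal ^ 3)) * N)

/-- item stmt-AtomisticToContinuum-13027 · crux · rank 4 · open · by planner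
why it might fail: It IS TL ground-state BEC at Bogoliubov rate on the torus (open: "still not within reach", Junge2026, ChongLiangNam2026); the amplitude-gas route to it needs #2 + the contraction behind #3, whose linked-cluster reorganisation may not converge (r⁻⁴ tails, d = 3 logs via h₃).
sources: CarlenJauslinLieb2021, CarlenJauslinLieb2020, Lieb1963, Jauslin2025, LSSY2005, FournaisSolovej2020
[crux] (card C2 output node, what BEC needs) for every repulsive finite-range radial v there are C
and ρ₀ > 0 such that for 0 < ρ < ρ₀, eventually in N, for every μ > 0: inf over periodic trial
states Ψ on the torus of side L = (N/ρ)^(1/3) of [periodicEnergy v Ψ + μ(N − condensateOccupation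
Ψ)] ≤ periodicGroundStateEnergy v N L + μ·C√(ρa³)·N, a = scatteringLength v. Equivalent by concavity
to the same for μ ∈ (0, μ₀]; equivalent, given SlopeToCondensation's spectral input, to ground-state
depletion ≤ C√(ρa³)N. One-line corollary of CJLSlopeBound (θ = 1); expected C → 8/(3√π) = 1.5045.
Sanity: v ≡ 0 gives 0 ≤ 0 (the constant state has condensateOccupation exactly N); hard cores
consistent (every finite-energy Ψ has depletion ≥ (π/6)ρR₀³N ≪ √(ρa³)N). [deps: CJLSlopeBound]
[difficulty: open-problem] -/
@[route_item "route-AtomisticToContinuum-BECAmplitudeGas", crux]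
def PinnedSlopeBound : Prop :=
  ∀ v : ℝ → ENNReal, Literature.MathematicalPhysics.QuantumManyBody.BoseGas.IsRepulsiveFiniteRange v → ∃ C ρ₀ : ℝ, 0 < ρ₀ ∧ ∀ ρ : ℝ, 0 < ρ → ρ < ρ₀ → ∀ᶠ N : ℕ in Filter.atTop, ∀ μ : ℝ, 0 < μ → (⨅ Ψ : Literature.MathematicalPhysics.QuantumManyBody.BoseGas.PeriodicTrialState N (Literature.MathematicalPhysics.QuantumManyBody.BoseGas.sideLength ρ N), Literature.MathematicalPhysics.QuantumManyBody.BoseGas.periodicEnergy v Ψ + ENNReal.ofReal μ * ((N : ENNReal) - Literature.MathematicalPhysics.QuantumManyBody.BoseGas.condensateOccupation N (Literature.MathematicalPhysics.QuantumManyBody.BoseGas.sideLength ρ N) Ψ.ψ)) ≤ Literature.MathematicalPhysics.QuantumManyBody.BoseGas.periodicGroundStateEnergy v N (Literature.MathematicalPhysics.QuantumManyBody.BoseGas.sideLength ρ N) + ENNReal.ofReal (μ * (C * Real.sqrt (ρ * (Literature.MathematicalPhysics.QuantumManyBody.BoseGas.scatteringLength v).toReal ^ 3)) * N)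

/-- item stmt-AtomisticToContinuum-13028 · crux · rank 5 · open · by planner
why it might fail: No accepted TL-BEC theorem at ANY density (Sütő's T>0 claim for exactly this class, arXiv:2208.08931/2305.18959, is unrefereed, unused since; Junge2026: TL 'not within reach'); at fixed v ρξ³ = ρ^(−1/2)v̂(0)^(−3/2) → 0: Bogoliubov's parameter fails; positive type essential (v̂(k₀)<0: crystal).
sources: Lieb1963, CarlenJauslinLieb2020, GiulianiSeiringer2009, Seiringer2011, CarlenEtAl2021, LSSY2005
[crux] (card target HighDensityTLBEC, the dense-first calibration rung; deliberately outside the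
deciding chain) for every BOUNDED, POSITIVE-TYPE (Σ_(x,y∈s) w_x w_y v(|x−y|) ≥ 0 for all finite s ⊂
ℝ³ and real weights w), repulsive finite-range radial v there is ρ₁ such that for every ρ > ρ₁ there
is c > 0 with: eventually in N there is δ > 0 such that every periodic trial state on the torus of
side (N/ρ)^(1/3) with periodicEnergy ≤ E₀^per + δ has condensateOccupation ≥ cN. This is the density
axis on which the Born approximation (a ≈ a₀), Lieb's bounds ρv̂(0)/2 − v(0)/2 ≤ e ≤ ρv̂(0)/2 and
the CJL closure are simultaneously asymptotically exact, and where Bogoliubov predicts a depletion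
FRACTION O(ρ^(−1/2)) (up to logs) → 0; class member: v = χ_B ∗ χ_B (autocorrelation of a ball
indicator: bounded, non-negative, finite range, positive type). [difficulty: open-problem] -/
@[route_item "route-AtomisticToContinuum-BECAmplitudeGas"]
def HighDensityCondensation : Prop :=
  ∀ v : ℝ → ENNReal, Literature.MathematicalPhysics.QuantumManyBody.BoseGas.IsRepulsiveFiniteRange v → (∃ M : NNReal, ∀ r : ℝ, v r ≤ (M : ENNReal)) → (∀ (s : Finset Literature.MathematicalPhysics.QuantumManyBody.BoseGas.Space) (w : Literature.MathematicalPhysics.QuantumManyBody.BoseGas.Space → ℝ), 0 ≤ ∑ x ∈ s, ∑ y ∈ s, w x * w y * (v (dist x y)).toReal) → ∃ ρ₁ : ℝ, 0 < ρ₁ ∧ ∀ ρ : ℝ, ρ₁ < ρ → ∃ c : ℝ, 0 < c ∧ ∀ᶠ N : ℕ in Filter.atTop, ∃ δ : ENNReal, 0 < δ ∧ ∀ Ψ : Literature.MathematicalPhysics.QuantumManyBody.BoseGas.PeriodicTrialState N (Literature.MathematicalPhysics.QuantumManyBody.BoseGas.sideLength ρ N), Literature.MathematicalPhysics.QuantumManyBody.BoseGas.periodicEnergy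 v Ψ ≤ Literature.MathematicalPhysics.QuantumManyBody.BoseGas.periodicGroundStateEnergy v N (Literature.MathematicalPhysics.QuantumManyBody.BoseGas.sideLength ρ N) + δ → ENNReal.ofReal (c * N) ≤ Literature.MathematicalPhysics.QuantumManyBody.BoseGas.condensateOccupation N (Literature.MathematicalPhysics.QuantumManyBody.BoseGas.sideLength ρ N) Ψ.ψ

/-- item stmt-AtomisticToContinuum-13029 · crux · rank 6 · open · by planner
why it might fail: v = ⊤ shells or hard cores disconnect configuration space; with a degenerate ground space ∂⁺_μE^(μ)(0) is the MINIMUM depletion over ground states, so the slope certifies only the best ground state while near-minimisers reach the worst (low-density hard-sphere connectivity is open).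
sources: CarlenJauslinLieb2021, ReedSimonIV1978, BaryshnikovBubenikKahle2013, LSSY2005
[crux] (fixed-N Hellmann–Feynman transfer, card C3) for every repulsive finite-range v there is ρ₁ >
0 such that for 0 < ρ < ρ₁, eventually in N, for every real η ≥ 0: if for all μ > 0 the pinned
infimum is ≤ E₀^per + μηN, then for every ε > 0 there is δ > 0 such that every periodic
δ-near-minimiser has condensateOccupation ≥ (1 − η − ε)N. Proof shape: E₀^per < ⊤ at low density
(hard cores: symmetrised lattice trial state); H + μN₊ has compact resolvent and, for μ ≥ 0, a
positivity-improving semigroup (e^(tμΣP_j) has a non-negative kernel), hence a unique positive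
gapped ground state ψ₀; second-order perturbation E^(μ) ≥ E₀ + μ⟨N₊⟩₀ − c_N μ² gives ⟨N₊⟩₀ ≤ ηN;
near-minimisers are L²-close to ψ₀ by the gap and √occupation is √N-Lipschitz in L². [difficulty: M] -/
@[route_item "route-AtomisticToContinuum-BECAmplitudeGas", crux]
def SlopeToCondensation : Prop :=
  ∀ v : ℝ → ENNReal, Literature.MathematicalPhysics.QuantumManyBody.BoseGas.IsRepulsiveFiniteRange v → ∃ ρ₁ : ℝ, 0 < ρ₁ ∧ ∀ ρ : ℝ, 0 < ρ → ρ < ρ₁ → ∀ᶠ N : ℕ in Filter.atTop, ∀ η : ℝ, 0 ≤ η → (∀ μ : ℝ, 0 < μ → (⨅ Ψ : Literature.MathematicalPhysics.QuantumManyBody.BoseGas.PeriodicTrialState N (Literature.MathematicalPhysics.QuantumManyBody.BoseGas.sideLength ρ N), Literature.MathematicalPhysics.QuantumManyBody.BoseGas.periodicEnergy v Ψ + ENNReal.ofReal μ * ((N : ENNReal) - Literature.MathematicalPhysics.QuantumManyBody.BoseGas.condensateOccupation N (Literature.MathematicalPhysics.QuantumManyBody.BoseGas.sideLength ρ N) Ψ.ψ))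 ≤ Literature.MathematicalPhysics.QuantumManyBody.BoseGas.periodicGroundStateEnergy v N (Literature.MathematicalPhysics.QuantumManyBody.BoseGas.sideLength ρ N) + ENNReal.ofReal (μ * η * N)) → ∀ ε : ℝ, 0 < ε → ∃ δ : ENNReal, 0 < δ ∧ ∀ Ψ : Literature.MathematicalPhysics.QuantumManyBody.BoseGas.PeriodicTrialState N (Literature.MathematicalPhysics.QuantumManyBody.BoseGas.sideLength ρ N), Literature.MathematicalPhysics.QuantumManyBody.BoseGas.periodicEnergy v Ψ ≤ Literature.MathematicalPhysics.QuantumManyBody.BoseGas.periodicGroundStateEnergy v N (Literature.MathematicalPhysics.QuantumManyBody.BoseGas.sideLength ρ N) + δ → ENNReal.ofReal ((1 - η - ε) * N) ≤ Literature.MathematicalPhysics.QuantumManyBody.BoseGas.condensateOccupation N (Literature.MathematicalPhysics.QuantumManyBody.BoseGas.sideLength ρ N) Ψ.ψ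

/-- item stmt-AtomisticToContinuum-0827 · crux · rank 7 · open · by planner
why it might fail: The Dirichlet ground state lies a wall term ≫ the near-minimiser slack N/L² above E₀^per and interior restrictions are neither periodic nor of sharp N, so the periodic hypothesis may never fire; only the ENERGY transfer is in print (Robinson1976).
sources: LSSY2005, Robinson1976, BoccatoSeiringer2023, Junge2026
[crux] BoundaryTransferWeak (mode-free boundary-condition transfer, per potential): for each
repulsive finite-range v, PeriodicBEC(v) implies ∃ρ₀>0 ∀ρ∈(0,ρ₀) HasGroundStateBEC v ρ (Dirichlet
ground state, λ_max(γ) ≥ cN via condensateNumber). Not glue: near-minimiser slacks are O(N/L²) while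
Dirichlet/periodic energies differ by a boundary term ≫ N/L², so no energy-comparison proof;
expected route: Neumann bracketing of interior sub-boxes (−Δ_Dir ≥ ⊕−Δ_Neu, v ≥ 0) + a mode-free
criterion (λ_max ≥ tr γ²/N). Only the ENERGY analogue is in print (LiebSeiringerSolovejYngvason2005
Ch. 2 after (2.8)). v ≡ 0: hypothesis and conclusion both true. -/
@[route_item "route-AtomisticToContinuum-BECAmplitudeGas", crux]
def BoundaryTransferWeak : Prop :=
  ∀ v : ℝ → ENNReal, Literature.MathematicalPhysics.QuantumManyBody.BoseGas.IsRepulsiveFiniteRange v → (∃ ρ₀ : ℝ, 0 < ρ₀ ∧ ∀ ρ : ℝ, 0 < ρ → ρ < ρ₀ → ∃ c : ℝ, 0 < c ∧ ∀ᶠ N : ℕ in Filter.atTop, ∃ δ : ENNReal, 0 < δ ∧ ∀ Ψ : Literature.MathematicalPhysics.QuantumManyBody.BoseGas.PeriodicTrialState N (Literature.MathematicalPhysics.QuantumManyBody.BoseGas.sideLength ρ N), Literature.MathematicalPhysics.QuantumManyBody.BoseGas.periodicEnergy v Ψ ≤ Literature.MathematicalPhysics.QuantumManyBody.BoseGas.periodicGroundStateEnergy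 v N (Literature.MathematicalPhysics.QuantumManyBody.BoseGas.sideLength ρ N) + δ → ENNReal.ofReal (c * N) ≤ Literature.MathematicalPhysics.QuantumManyBody.BoseGas.condensateOccupation N (Literature.MathematicalPhysics.QuantumManyBody.BoseGas.sideLength ρ N) Ψ.ψ) → ∃ ρ₀ : ℝ, 0 < ρ₀ ∧ ∀ ρ : ℝ, 0 < ρ → ρ < ρ₀ → Literature.MathematicalPhysics.QuantumManyBody.BoseGas.HasGroundStateBEC v ρ

/-- item stmt-AtomisticToContinuum-13030 · support · rank 9 · open · by planner
sources: Lieb1963, Jauslin2025, CarlenJauslinLieb2021, ReedSimonIV1978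
[support] (Lieb's starting identity, pinned version; card C3) for bounded repulsive finite-range v,
N, L > 0, μ ≥ 0 and ε > 0 there is δ > 0 such that every NON-NEGATIVE periodic trial state Ψ that is
a δ-near-minimiser of the pinned functional periodicEnergy + μ(N − condensateOccupation) satisfies
|E^(μ)(N,L)·∫_(cell^N)Ψ − ∫_(cell^N)(Σ_(i<j) v^per(x_i − x_j))Ψ| ≤ ε∫_(cell^N)Ψ (two ENNReal
inequalities): the pinned energy is the pair-energy of the amplitude gas, E^(μ)/N = ((N−1)/2V)∫v^per
g₂^(μ), with NO kinetic and NO pinning term (⟨1, Δψ⟩ = 0 on the torus and ⟨1, (1 − P_j)ψ⟩ = 0: the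
pin closes downward). Proof: uniqueness and positivity of the pinned ground state for μ ≥ 0,
L²-convergence of near-minimisers on the finite cell (their overlap with ψ₀ controls ∫Ψ since ∫ψ₀ >
0), ⟨1, H^(μ)ψ₀⟩ = E^(μ)⟨1, ψ₀⟩ with v^per bounded; the functional is LINEAR in the amplitude gas,
so no spike control is needed. [difficulty: M] -/
@[route_item "route-AtomisticToContinuum-BECAmplitudeGas"]
def AmplitudeEnergyIdentity : Prop :=
  ∀ v : ℝ → ENNReal, Literature.MathematicalPhysics.QuantumManyBody.BoseGas.IsRepulsiveFiniteRange v → (∃ M : NNReal, ∀ r : ℝ, v r ≤ (M : ENNReal)) → ∀ (N : ℕ) (L μ : ℝ), 0 < L → 0 ≤ μ → ∀ ε : ℝ, 0 < ε → ∃ δ : ENNReal, 0 < δ ∧ ∀ Ψ : Literature.MathematicalPhysics.QuantumManyBody.BoseGas.PeriodicTrialState N L, (∀ X, Ψ.ψ X = (‖Ψ.ψ X‖ : ℂ)) → Literature.MathematicalPhysics.QuantumManyBody.BoseGas.periodicEnergy v Ψ + ENNReal.ofReal μ * ((N : ENNReal) - Literature.MathematicalPhysics.QuantumManyBody.BoseGas.condensateOccupation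 N L Ψ.ψ) ≤ (⨅ Φ : Literature.MathematicalPhysics.QuantumManyBody.BoseGas.PeriodicTrialState N L, Literature.MathematicalPhysics.QuantumManyBody.BoseGas.periodicEnergy v Φ + ENNReal.ofReal μ * ((N : ENNReal) - Literature.MathematicalPhysics.QuantumManyBody.BoseGas.condensateOccupation N L Φ.ψ)) + δ → (⨅ Φ : Literature.MathematicalPhysics.QuantumManyBody.BoseGas.PeriodicTrialState N L, Literature.MathematicalPhysics.QuantumManyBody.BoseGas.periodicEnergy v Φ + ENNReal.ofReal μ * ((N : ENNReal) - Literature.MathematicalPhysics.QuantumManyBody.BoseGas.condensateOccupation N L Φ.ψ)) * (∫⁻ X in Literature.MathematicalPhysics.QuantumManyBody.BoseGas.cellN N L, (‖Ψ.ψ X‖₊ : ENNReal)) ≤ (∫⁻ X in Literature.MathematicalPhysics.QuantumManyBody.BoseGas.cellN N L, Literature.MathematicalPhysics.QuantumManyBody.BoseGas.periodicInteraction v L X * (‖Ψ.ψ X‖₊ : ENNReal)) + ENNReal.ofReal ε * (∫⁻ X in Literature.MathematicalPhysics.QuantumManyBody.BoseGas.cellN N L, (‖Ψ.ψ X‖₊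 : ENNReal)) ∧ (∫⁻ X in Literature.MathematicalPhysics.QuantumManyBody.BoseGas.cellN N L, Literature.MathematicalPhysics.QuantumManyBody.BoseGas.periodicInteraction v L X * (‖Ψ.ψ X‖₊ : ENNReal)) ≤ (⨅ Φ : Literature.MathematicalPhysics.QuantumManyBody.BoseGas.PeriodicTrialState N L, Literature.MathematicalPhysics.QuantumManyBody.BoseGas.periodicEnergy v Φ + ENNReal.ofReal μ * ((N : ENNReal) - Literature.MathematicalPhysics.QuantumManyBody.BoseGas.condensateOccupation N L Φ.ψ)) * (∫⁻ X in Literature.MathematicalPhysics.QuantumManyBody.BoseGas.cellN N L, (‖Ψ.ψ X‖₊ : ENNReal)) + ENNReal.ofReal ε * (∫⁻ X in Literature.MathematicalPhysics.QuantumManyBody.BoseGas.cellN N L, (‖Ψ.ψ X‖₊ : ENNReal))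

/-- item stmt-AtomisticToContinuum-13031 · assembly · rank 1 · open · by planner
sources: LSSY2005, CarlenJauslinLieb2021
[assembly] PinnedSlopeBound → SlopeToCondensation → BoundaryTransferWeak → BoseEinsteinCondensation
(the deciding theorem `closes` has exactly these three hypotheses). -/
@[route_item "route-AtomisticToContinuum-BECAmplitudeGas"]
def Assembly : Prop :=
  PinnedSlopeBound → SlopeToCondensation → BoundaryTransferWeak → BoseEinsteinCondensation

/-! D-0027 §2.1 — DECIDING THEOREM (planner-authored via `route open/edit --closes-file`; by planner-plancard-AtomisticToContinuum-BoseEin-43545e8e-g2-0 2026-08-15T18:57:08Z):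
its hypotheses are this route's items and its conclusion the sub-problem Statement (glue_lint), and it elaborates with this file. -/

@[closes "route-AtomisticToContinuum-BECAmplitudeGas"] theorem closes (h₁ : PinnedSlopeBound) (h₂ : SlopeToCondensation) (h₃ : BoundaryTransferWeak) :
    BoseEinsteinCondensation := by
  intro v hv
  apply h₃ v hv
  obtain ⟨C, ρ₀, hρ₀, hP⟩ := h₁ v hv
  obtain ⟨ρ₁, hρ₁, hS⟩ := h₂ v hv
  have ha : 0 ≤ (Literature.MathematicalPhysics.QuantumManyBody.BoseGas.scatteringLength v).toReal :=
    ENNReal.toReal_nonneg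
  have hCa : 0 ≤ C ^ 2 * (Literature.MathematicalPhysics.QuantumManyBody.BoseGas.scatteringLength v).toReal ^ 3 :=
    mul_nonneg (sq_nonneg C) (pow_nonneg ha 3)
  have hd : 0 < 16 * (C ^ 2 * (Literature.MathematicalPhysics.QuantumManyBody.BoseGas.scatteringLength v).toReal ^ 3) + 1 := by
    linarith
  refine ⟨min ρ₀ (min ρ₁ (1 / (16 * (C ^ 2 *
    (Literature.MathematicalPhysics.QuantumManyBody.BoseGas.scatteringLength v).toReal ^ 3) + 1))), ?_, ?_⟩
  · exact lt_min hρ₀ (lt_min hρ₁ (by positivity))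
  intro ρ hρ hρlt
  have hρ0 : ρ < ρ₀ := lt_of_lt_of_le hρlt (min_le_left _ _)
  have hρ1 : ρ < ρ₁ := lt_of_lt_of_le hρlt ((min_le_right _ _).trans (min_le_left _ _))
  have hρs : ρ < 1 / (16 * (C ^ 2 *
      (Literature.MathematicalPhysics.QuantumManyBody.BoseGas.scatteringLength v).toReal ^ 3) + 1) :=
    lt_of_lt_of_le hρlt ((min_le_right _ _).trans (min_le_right _ _))
  refine ⟨1 / 2, by norm_num, ?_⟩
  filter_upwards [hP ρ hρ hρ0, hS ρ hρ hρ1] with N hPN hSN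
  -- the rate η := max (C √(ρ a³)) 0 is at most 1/4 on the chosen density window
  set s : ℝ := Real.sqrt (ρ * (Literature.MathematicalPhysics.QuantumManyBody.BoseGas.scatteringLength v).toReal ^ 3)
    with hs_def
  have hρd : ρ * (16 * (C ^ 2 *
      (Literature.MathematicalPhysics.QuantumManyBody.BoseGas.scatteringLength v).toReal ^ 3) + 1) < 1 := by
    rwa [lt_div_iff₀ hd] at hρs
  have hx : C ^ 2 * (ρ * (Literature.MathematicalPhysics.QuantumManyBody.BoseGas.scatteringLength v).toReal ^ 3)
      ≤ 1 / 16 := by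
    nlinarith
  have hsq : (C * s) ^ 2 ≤ (1 / 4 : ℝ) ^ 2 := by
    rw [mul_pow, hs_def, Real.sq_sqrt (mul_nonneg hρ.le (pow_nonneg ha 3))]
    linarith
  have hCs : C * s ≤ 1 / 4 := by
    have h1 : |C * s| ≤ |(1 / 4 : ℝ)| := sq_le_sq.mp hsq
    rw [abs_of_pos (by norm_num : (0 : ℝ) < 1 / 4)] at h1
    exact (le_abs_self _).trans h1
  set η : ℝ := max (C * s) 0 with hη_def
  have hη0 : 0 ≤ η := le_max_right _ _
  have hη : η ≤ 1 / 4 := max_le hCs (by norm_num)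
  have hslope : ∀ μ : ℝ, 0 < μ →
      (⨅ Ψ : Literature.MathematicalPhysics.QuantumManyBody.BoseGas.PeriodicTrialState N
          (Literature.MathematicalPhysics.QuantumManyBody.BoseGas.sideLength ρ N),
        Literature.MathematicalPhysics.QuantumManyBody.BoseGas.periodicEnergy v Ψ +
          ENNReal.ofReal μ * ((N : ENNReal) -
            Literature.MathematicalPhysics.QuantumManyBody.BoseGas.condensateOccupation N
              (Literature.MathematicalPhysics.QuantumManyBody.BoseGas.sideLength ρ N) Ψ.ψ)) ≤
        Literature.MathematicalPhysics.QuantumManyBody.BoseGas.periodicGroundStateEnergy v N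
            (Literature.MathematicalPhysics.QuantumManyBody.BoseGas.sideLength ρ N) +
          ENNReal.ofReal (μ * η * N) := by
    intro μ hμ
    refine (hPN μ hμ).trans (add_le_add_right (ENNReal.ofReal_le_ofReal ?_) _)
    have h1 : μ * (C * s) ≤ μ * η := mul_le_mul_of_nonneg_left (le_max_left _ _) hμ.le
    exact mul_le_mul_of_nonneg_right h1 (Nat.cast_nonneg N)
  obtain ⟨δ, hδ, hΨ⟩ := hSN η hη0 hslope (1 / 4) (by norm_num)
  refine ⟨δ, hδ, fun Ψ hΨE => ?_⟩
  refine le_trans (ENNReal.ofReal_le_ofReal ?_) (hΨ Ψ hΨE)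
  exact mul_le_mul_of_nonneg_right (by linarith) (Nat.cast_nonneg N)

end Summit.AtomisticToContinuum.BoseEinsteinCondensation.Theses.BECAmplitudeGas
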